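import Summits.NavierStokesRegularity.NavierStokesRegularity.Theorems.PerpetualPumpPumpTransferSummation
import Summits.NavierStokesRegularity.NavierStokesRegularity.Theorems.PerpetualPumpPumpTransferMajorantOfEnvelope
import Summits.NavierStokesRegularity.NavierStokesRegularity.Theorems.PerpetualPumpPumpTransferNoLonger
import Summits.NavierStokesRegularity.NavierStokesRegularity.Theorems.PerpetualPumpAveragedTypeIBlowupKernel
import HarnessLib

/-!
# The chain-level threshold statement from a STAIRCASE CERTIFICATE (line `Sketch` v3 of crux
`PerpetualPump.PumpTransfer`, stmt-NavierStokesRegularity-1837; interface offered to stmt-1835)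

For a chain solution `Y` of Tao's band-kernel Volterra system (the class of stmt-1835: continuous on `[0,S)`,
no modes below `n₀`, `(1+ε₀)^{20n}`-weighted bounds on compact sub-intervals, the Volterra identity with the
kernels `k_{i,n}(τ) = Re⟨e^{τΔ}ψ_{i,n}, ψ_{i,n}⟩`) that carries a STAIRCASE CERTIFICATE — (Y1) the critical
envelope `|Y_{i,n}(s)| ≤ K (1+ε₀)^{-n/2}`; (Y2) geometric smallness above the front before each checkpoint,
`|Y_{i,n}(s)| ≤ K (1+ε₀)^{-n/2} (2(1+ε₀))^{n₀+k+1-n}` for `s < T_{k+1}`, `n ≥ n₀+k+2`; (Y3) checkpoints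
`T_k ∈ [0,S)`, `T_0 = 0`, with the Type-I clock `S − T_k ≤ c₂/(1+ε₀)^{2k}`; (Y4) a charged front carrier
`|Y_{i₀,n₀+k}(T_k)| ≥ b₀ (1+ε₀)^{-(n₀+k)/2}` — we derive the three conclusions of the chain-level threshold
theorem (stmt-1835's `stub_threshold`, verbatim shapes): the TYPE-I FUNCTIONAL BOUND on Tao's band majorants,
WEIGHTED UNBOUNDEDNESS in the `H¹⁰` weight, and NON-EXISTENCE of a chain solution on a longer interval.
Composition of the landed `stub_majorantOfEnvelope`, `stub_summation`, `stub_noLonger` and `stub_kernel`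
(`k(0) = 1`). This is the end game of the window-one-step/IVT construction; whoever produces the certificate
(this line's `stub_staircase`, or stmt-1835's `stub_thresholdCore`) closes both cruxes through it.
-/

set_option linter.dupNamespace false

noncomputable section

open MeasureTheory Set Filter Topology
open scoped ENNReal
open Literature.Analysis.FluidPDE Literature.Analysis.FluidPDE.Tao2016
open Literature.Analysis.FluidPDE.TaoCascade (quadTerm IsSymmetricCoeff IsCancellingCoeff)
open Summit.NavierStokesRegularity.NavierStokesRegularity.Theorems.PerpetualPumpAveragedTypeIBlowup

namespace Summit.NavierStokesRegularity.NavierStokesRegularity.Theorems.PerpetualPumpPumpTransfer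

/-- **Weighted unboundedness from a charged front and checkpoints inside the lifespan.** If at times
`T_k ∈ [0,S)` the front carrier obeys `|Y_{i₀,n₀+k}(T_k)| ≥ b₀ (1+ε₀)^{-(n₀+k)/2}` with `b₀ > 0`, then
`(1+ε₀)^{10n}|Y_{i,n}(t)|` is unbounded on `[0,S)` (it is `≥ b₀ (1+ε₀)^{19(n₀+k)/2} → ∞`). [folklore] -/
theorem unbounded_of_chargedFront {ε₀ : ℝ} (hε₀ : 0 < ε₀) {m : ℕ} (i₀ : Fin m) (n₀ : ℤ) (S b₀ : ℝ)
    (T : ℕ → ℝ) (Y : Fin m → ℤ → ℝ → ℝ) (hb₀ : 0 < b₀) (hT : ∀ k : ℕ, 0 ≤ T k ∧ T k < S)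
    (hY : ∀ k : ℕ, b₀ * (1 + ε₀) ^ (-((n₀ + k : ℤ) : ℝ) / 2) ≤ |Y i₀ (n₀ + k) (T k)|) :
    ∀ C : ℝ, ∃ t ∈ Ico 0 S, ∃ (i : Fin m) (n : ℤ), C < (1 + ε₀) ^ ((10 : ℝ) * n) * |Y i n t| := by
  intro C
  have hl : (1 : ℝ) < 1 + ε₀ := by linarith
  have hl0 : (0 : ℝ) < 1 + ε₀ := by linarith
  -- the lower bound `b₀ (1+ε₀)^{19 (n₀+k)/2}` tends to `+∞` with `k`
  have htend : Tendsto (fun k : ℕ => b₀ * (1 + ε₀) ^ ((19 : ℝ) * ((n₀ + k : ℤ) : ℝ) / 2)) atTop atTop := by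
    refine Tendsto.const_mul_atTop hb₀ ?_
    have h1 : Tendsto (fun k : ℕ => (19 : ℝ) * ((n₀ + k : ℤ) : ℝ) / 2) atTop atTop := by
      have : Tendsto (fun k : ℕ => ((n₀ + k : ℤ) : ℝ)) atTop atTop := by
        refine tendsto_atTop_atTop.2 fun b => ⟨Nat.ceil (b - n₀), fun k hk => ?_⟩
        have hk' : (b - n₀ : ℝ) ≤ k := (Nat.le_ceil _).trans (by exact_mod_cast hk)
        push_cast
        linarith
      refine Tendsto.atTop_div_const (by norm_num) (Tendsto.const_mul_atTop (by norm_num) this)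
    exact (tendsto_rpow_atTop_of_base_gt_one _ hl).comp h1
  obtain ⟨k, hk⟩ := (htend.eventually_gt_atTop C).exists
  refine ⟨T k, ⟨(hT k).1, (hT k).2⟩, i₀, n₀ + k, lt_of_lt_of_le hk ?_⟩
  have hpow : (1 + ε₀) ^ ((19 : ℝ) * ((n₀ + k : ℤ) : ℝ) / 2) =
      (1 + ε₀) ^ ((10 : ℝ) * ((n₀ + k : ℤ) : ℝ)) * (1 + ε₀) ^ (-((n₀ + k : ℤ) : ℝ) / 2) := by
    rw [← Real.rpow_add hl0]
    congr 1
    ring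
  rw [hpow, mul_comm b₀, mul_assoc]
  refine mul_le_mul_of_nonneg_left ?_ (Real.rpow_nonneg hl0.le _)
  simpa [mul_comm] using hY k

/-- **The chain-level threshold statement from a staircase certificate.** For `0 < ε₀ ≤ 1`, wavelet data
`𝒟`, structure constants `α`, a ray datum `A ψ_{i₀,n₀}` and a chain solution `Y` on `[0,S)` in the class of
stmt-1835 that carries the staircase certificate (Y1)–(Y4) (constants `K ≥ 0`, `c₂ > 0`, `b₀ > 0`,
checkpoints `T`), the three conclusions of the chain-level Type-I threshold theorem hold: (i) the TYPE-I
FUNCTIONAL BOUND `Σ_{i,n} (1+ε₀)^{3n/2} b_{i,n}(t) ≤ M (S−t)^{-1/2}` on Tao's band majorants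
`b_{i,n}(t) = e^{-4π²(1+ε₀)^{2n}t}|A|1_{(i,n)=(i₀,n₀)} + ∫₀ᵗ |quadTerm(Y)_{i,n}(s)| e^{-4π²(1+ε₀)^{2n}(t-s)} ds`
(`stub_majorantOfEnvelope` + `stub_summation`; the datum bound comes from (Y1) at `t = 0` and `k_{i₀,n₀}(0) = 1`);
(ii) WEIGHTED UNBOUNDEDNESS of `(1+ε₀)^{10n}|Y_{i,n}(t)|` on `[0,S)` (`unbounded_of_chargedFront`);
(iii) NO chain solution of the class from the same datum exists on any `[0,S')`, `S' > S` (`stub_noLonger`).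
[cite: Tao2016AveragedNS, §5.2 Prop. 5.1 and §4 (4.14)] -/
theorem threshold_of_certificate :
    ∀ {ε₀ : ℝ}, 0 < ε₀ → ε₀ ≤ 1 → ∀ {m : ℕ} (𝒟 : CascadeWaveletData ε₀ m)
      (α : Fin m → Fin m → Fin m → ℤ × ℤ × ℤ → ℝ) (i₀ : Fin m) (n₀ : ℤ)
      (A S K c₂ b₀ : ℝ) (T : ℕ → ℝ) (Y : Fin m → ℤ → ℝ → ℝ),
      0 < S → 0 ≤ K → 0 < c₂ → 0 < b₀ →
      (∀ i n, ContinuousOn (Y i n) (Ico 0 S)) →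
      (∀ i n t, n < n₀ → Y i n t = 0) →
      (∀ S' : ℝ, S' < S → ∃ C : ℝ, ∀ (i : Fin m) (n : ℤ), ∀ t ∈ Icc 0 S',
        (1 + ε₀) ^ ((20 : ℝ) * n) * |Y i n t| ≤ C) →
      (∀ (i : Fin m) (n : ℤ), ∀ t ∈ Ico 0 S,
        Y i n t = (if i = i₀ ∧ n = n₀ then A else 0) *
            (pairing (heat t (cascadeWavelet ε₀ (𝒟.ψ i) n)) (cascadeWavelet ε₀ (𝒟.ψ i) n)).re +
          ∫ s in (0 : ℝ)..t,
            (pairing (heat (t - s) (cascadeWavelet ε₀ (𝒟.ψ i) n)) (cascadeWavelet ε₀ (𝒟.ψ i) n)).re *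
              quadTerm ε₀ α Y i n s) →
      (∀ (i : Fin m) (n : ℤ), ∀ s ∈ Ico 0 S, |Y i n s| ≤ K * (1 + ε₀) ^ (-(n : ℝ) / 2)) →
      T 0 = 0 → (∀ k : ℕ, 0 ≤ T k ∧ T k < S) →
      (∀ k : ℕ, S - T k ≤ c₂ / (1 + ε₀) ^ (2 * k)) →
      (∀ k : ℕ, ∀ s ∈ Ico 0 (T (k + 1)), s < S → ∀ (i : Fin m) (n : ℤ), n₀ + k + 2 ≤ n →
        |Y i n s| ≤ K * (1 + ε₀) ^ (-(n : ℝ) / 2) * (2 * (1 + ε₀)) ^ (n₀ + k + 1 - n)) →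
      (∀ k : ℕ, b₀ * (1 + ε₀) ^ (-((n₀ + k : ℤ) : ℝ) / 2) ≤ |Y i₀ (n₀ + k) (T k)|) →
      (∃ M : ℝ, ∀ t ∈ Ico 0 S,
        (∑' p : Fin m × ℤ, ENNReal.ofReal ((1 + ε₀) ^ ((3 : ℝ) * p.2 / 2) *
          (Real.exp (-(4 * Real.pi ^ 2 * (1 + ε₀) ^ (2 * p.2) * t)) *
              (if p.1 = i₀ ∧ p.2 = n₀ then |A| else 0) +
            ∫ s in (0 : ℝ)..t, |quadTerm ε₀ α Y p.1 p.2 s| *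
              Real.exp (-(4 * Real.pi ^ 2 * (1 + ε₀) ^ (2 * p.2) * (t - s)))))) ≤
          ENNReal.ofReal (M / Real.sqrt (S - t))) ∧
      (∀ C : ℝ, ∃ t ∈ Ico 0 S, ∃ (i : Fin m) (n : ℤ), C < (1 + ε₀) ^ ((10 : ℝ) * n) * |Y i n t|) ∧
      ¬ ∃ (S' : ℝ) (Y' : Fin m → ℤ → ℝ → ℝ), S < S' ∧
        (∀ i n, ContinuousOn (Y' i n) (Ico 0 S')) ∧
        (∀ i n t, n < n₀ → Y' i n t = 0) ∧
        (∀ S'' : ℝ, S'' < S' → ∃ C : ℝ, ∀ (i : Fin m) (n : ℤ), ∀ t ∈ Icc 0 S'',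
          (1 + ε₀) ^ ((20 : ℝ) * n) * |Y' i n t| ≤ C) ∧
        (∀ (i : Fin m) (n : ℤ), ∀ t ∈ Ico 0 S',
          Y' i n t = (if i = i₀ ∧ n = n₀ then A else 0) *
              (pairing (heat t (cascadeWavelet ε₀ (𝒟.ψ i) n)) (cascadeWavelet ε₀ (𝒟.ψ i) n)).re +
            ∫ s in (0 : ℝ)..t,
              (pairing (heat (t - s) (cascadeWavelet ε₀ (𝒟.ψ i) n)) (cascadeWavelet ε₀ (𝒟.ψ i) n)).re *
                quadTerm ε₀ α Y' i n s) := by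
  intro ε₀ hε₀ hε₁ m 𝒟 α i₀ n₀ A S K c₂ b₀ T Y hS hK hc₂ hb₀ hcont hlow hdec hchain hY1 hT0 hT hclock hY2 hY4
  -- the datum bound `|A| ≤ K (1+ε₀)^{-n₀/2}` from (Y1) at `t = 0` and `k(0) = 1`
  have hA : |A| ≤ K * (1 + ε₀) ^ (-(n₀ : ℝ) / 2) := by
    have h0 : (0 : ℝ) ∈ Ico 0 S := ⟨le_rfl, hS⟩
    have hk0 := (stub_kernel hε₀ hε₁ 𝒟 i₀ n₀).1
    have hY0 : Y i₀ n₀ 0 = A := by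
      rw [hchain i₀ n₀ 0 h0, hk0]
      simp
    have := hY1 i₀ n₀ 0 h0
    rwa [hY0] at this
  obtain ⟨K', hK', hB0, hB1, hB2⟩ :=
    stub_majorantOfEnvelope hε₀ hε₁ α i₀ n₀ A S K T Y hK hcont hlow hA hY1 hY2
  obtain ⟨M, hM⟩ := stub_summation hε₀ hε₁ n₀ S K' c₂ T
    (fun i n t => Real.exp (-(4 * Real.pi ^ 2 * (1 + ε₀) ^ (2 * n) * t)) *
        (if i = i₀ ∧ n = n₀ then |A| else 0) +
      ∫ s in (0 : ℝ)..t, |quadTerm ε₀ α Y i n s| * Real.exp (-(4 * Real.pi ^ 2 * (1 + ε₀) ^ (2 * n) * (t - s))))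
    hS hK' hc₂ hT0 hclock (fun i n t hn => (hB0 i n t hn).le) hB1 hB2
  have hunb := unbounded_of_chargedFront hε₀ i₀ n₀ S b₀ T Y hb₀ hT hY4
  exact ⟨⟨M, hM⟩, hunb, stub_noLonger hε₀ hε₁ 𝒟 α i₀ n₀ A S Y hS hcont hlow hdec hchain hunb⟩

end Summit.NavierStokesRegularity.NavierStokesRegularity.Theorems.PerpetualPumpPumpTransfer

end
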